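import Literature.Topology.FourManifolds.LefschetzHandlebody
import Summits.SmoothPoincare4.SmoothPoincare4.Theorems.ConvexBisectionAcyclicBisectionExistsMultiAttachmentHomologyLoops
import HarnessLib

/-!
# Kas' longitude formula (G) for NF2 clause 3: the convention computation, the model loops, and
# loop reversal (wave 4, W4-G; sub-goal `stub_Kas_loopClass_reverse` of stub `stub_modelsOn_counts`,
line `modp-braid-orbits`, r9, crux `ConvexBisection.AcyclicBisectionExists`, stmt-SmoothPoincare4-10508)

Lemma (G) of the Kas design (`work/stubs/Kas_Design.lean`, W3-1) is the one convention-sensitive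
input of Kas' presentation `H₁(∂X(F; l); ℤ) ≅ coker(wordProduct (stdSymp ℤ g) l − 1)` (K2, whence
NF2 clause 3 `wordProduct (stdSymp ℤ g) l = 1` over a homotopy sphere): in `H₁(∂ Base g ∖ ⋃ Kᵢ; ℤ)`
the handle-framing longitude of `Kᵢ` should read `ℓᵢ = P(γᵢ) + εᵢ mᵢ + Σ_{j>i} stdSymp(γⱼ, γᵢ) mⱼ`.
The algebra `kas_coker_equiv` (p121375) turns exactly this pattern into `coker(wordProduct l − 1)`;
with the opposite RELATIVE sign between the `εᵢ mᵢ` term and the crossing terms it yields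
`coker(wordProduct l.reverse − 1)` instead (`g = 1`, `l = [(e,+), (f,+), (e+f,+)]`:
`T_e T_f T_{e+f} = [[−1, 2], [−1, 1]]`, `|coker(· − 1)| = 2`, versus
`T_{e+f} T_f T_e = [[−1, 0], [−3, −1]]`, `|coker(· − 1)| = 4`).  This docstring records the paper
check asked for by the lead; the Lean content below is the loop vocabulary of the design (§1) and
the reversal lemma `[K ∘ conj] = −[K]` (§2, registered sub-goal §3) used by the mirror analysis of
`…KasMirror.lean`.

## 1. Conventions in force (all from `LefschetzBasePages.lean`, checked again here)

* Model loops (design §0).  `circlePt t = (cos 2πt, sin 2πt)`.  On the Clifford torus of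
  `S³ = ∂D⁴ ⊂ ℂ²` (`z₁ = x_λ`, `z₂ = x_μ`): attaching circle `S = {z₂ = 0}`, `θ ↦ (e^{2πiθ}, 0)`;
  LONGITUDE `θ ↦ (e^{2πiθ}, 1)/√2` = push-off of `S` along `e₂ = ∂/∂x_μ,₁`, i.e. along the handle
  framing `attachingFraming = dh̄(e₂)` (isotopic to it through `(cos s·θ, sin s·1)`, `s ∈ (0, π/4]`,
  off `S`); MERIDIAN `φ ↦ (1, e^{2πiφ})/√2`, isotopic in `S³ ∖ S` to `{z₁ = 0}` counter-clockwise,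
  so `lk(S, meridian) = lk(∂{z₂=0}, ∂{z₁=0}) = +1` in `∂(complex ball)` (positive Hopf link = link
  of `z₁ z₂ = 0`): the model meridian is the RIGHT-HANDED meridian of the model circle.
* (a) `∂ Base g` carries the boundary orientation of the complex domain; near a page point the
  frame `(K', iK', n)` is positive, `n = horizNormal`, `dΦ(n) = i·w·(>0)`, so `n` points to
  INCREASING `arg w`; `pageTwisting = wind` of `(⟨ν, iK'⟩, ⟨ν, n⟩)`, `wind` counter-clockwise
  positive (`wind_circleLoop_zero = 1`), i.e. `tw` = number of turns of `ν` from `iK'` towards `n`.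
  `IsLefschetzLink.twisting_eq`: `twᵢ = −εᵢ`, `εᵢ = sgn (l.get i).2` (`sgn true = 1`).
* (b) `Kᵢ ⊂ page (pageDir n i)`, `arg pageDir n i = −2π(i+½)/n ≡ 2π(1 − (i+½)/n)`: DEcreasing in
  `i`; the base page is `page g 1` (`arg w = 0`); the arc of angles `(0, arg pageDir n i)` contains
  exactly the letters `j > i`.
* (c) `σ(chainLoop i) = chainVec i`, and `chainLoop i · chainLoop (i+1) = +1` for the complex
  orientation of the page (re-derived: near the common branch point `y` is a holomorphic
  coordinate, loop `i` passes with direction `−r_in`, loop `i+1` with `+r_out`,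
  `r_in / r_out = e^{i(π−β)/2}`, `β = 2π/(2g+1)`; numerically for `g = 1, 2, 3` and all `i`:
  sign `+1`, ratio `0.8660+0.5000i` (`g=1`), `0.5878+0.8090i` (`g=2`), `0.4339+0.9010i` (`g=3`) as
  predicted); since `stdSymp(chainVec i, chainVec (i+1)) = 1` (Gram matrix tridiagonal `+1/−1`,
  checked) and both forms vanish on non-consecutive pairs, `x · y = stdSymp(σ x, σ y)` on
  `H₁(page)` (any page: the pages over `‖w‖ ≤ ½` form a trivial holomorphic family).

## 2. The computation (local model `F_ℂ × ℝ_s` of `∂ Base g` off the binding, `s = arg w`,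
## `n = ∂_s`; `μ⁺ⱼ` := meridian of `Kⱼ` turning from `iKⱼ'` towards `n` = right-handed meridian)

(i) CROSSING.  For an oriented curve `a` of the page and levels `s⁻ < sⱼ < s⁺` with only `Kⱼ` in
between, the annulus `A = a × [s⁻, s⁺]` oriented by `(a', ∂_s)` has `∂A = a×{s⁻} − a×{s⁺}`;
removing discs `D_p` around the points of `A ∩ Kⱼ` and using `∂(A ∖ ⋃ D_p) ∼ 0`:
`[a]_{s⁺} = [a]_{s⁻} − Σ_p [∂D_p]`, and `∂D_p` (boundary orientation from `A`) turns from `a'`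
towards `∂_s`, i.e. it is `sign(Kⱼ', a') · μ⁺ⱼ`.  Hence going UP across `Kⱼ`:
`[a]_{s⁺} = [a]_{s⁻} − (Kⱼ · a) μ⁺ⱼ = [a]_{s⁻} − stdSymp(γⱼ, a) μ⁺ⱼ`.
(Gauss-integral check in the model: `lk(K, [a]_{s⁺} − [a]_{s⁻}) = −1.000` for `K · a = +1`.)
(ii) FRAMING.  In `∂N(Kᵢ) ≅ Kᵢ × S¹` (normal circle oriented from `iK'` to `n`) the push-off along
a framing of winding `tw` is the curve `(t, tw·t)`, so `ℓᵢ^{handle} = ℓᵢ^{page} + twᵢ μ⁺ᵢ`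
(`ℓ^{page}` = push-off along `n`, `= [Kᵢ]_{sᵢ ± δ}`).  (Gauss check: `lk(K, μ⁺) = +1.000`,
`lk(K, push-off of twisting tw) = tw` for `tw = −1, 0, 1, 2`.)
(iii) TRANSPORT to the base page `0⁺` goes DOWN through the letters `j > i` (Convention (b)), so by
(i) `[Kᵢ]_{sᵢ−δ} = [γᵢ]_{0⁺} − Σ_{j>i} stdSymp(γⱼ, γᵢ) μ⁺ⱼ = P(γᵢ) − Σ_{j>i} stdSymp(γⱼ, γᵢ) μ⁺ⱼ`.
(iv) ASSEMBLY (`twᵢ = −εᵢ`):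

  `ℓᵢ = P(γᵢ) − εᵢ μ⁺ᵢ − Σ_{j>i} stdSymp(γⱼ, γᵢ) μ⁺ⱼ`,  and around the full circle (i) gives the
  page relations `Σⱼ stdSymp(γⱼ, a) μ⁺ⱼ = 0`.

With `mⱼ := −μ⁺ⱼ` (ALL meridians left-handed) this is VERBATIM the pattern of `kas_coker_equiv`:
relative sign `+`, `H₁(∂X) ≅ coker(wordProduct (stdSymp ℤ g) l − 1)`, NOT the reversed word.
VERDICT: NF2 clause 3 `wordProduct (stdSymp ℤ g) l = 1` is the right statement.  Cross-check by
the open book of `∂X`: (i)+(ii) make the gluing across `Kⱼ` act on `H₁(page)` as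
`a ↦ a + εⱼ stdSymp(γⱼ, a) γⱼ = transvection (γⱼ, εⱼ) a`, and travelling counter-clockwise from
the base page meets `n−1, …, 0`, so the homological monodromy is `T₀ ∘ ⋯ ∘ T_{n−1} = wordProduct l`
and `H₁ = coker(monodromy − 1)` agrees.  (Remark on (c)'s last sentence: the positive letter's
`transvection`, `a ↦ a + (γ·a)γ = a − (a·γ)γ`, is the action of the RIGHT-handed twist — the
monodromy of `z₁² + z₂²`, by the `A₁` computation `h(u) = u·e^{iπ(1−χ(|u|))}` — which is the
INVERSE of Farb–Margalit's `T_γ` (`[T_b a] = a + î(a,b) b`, a left twist); consistent.)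

## 3. Consequence for the design: the meridians must be oriented by `∂ Base g`

The design's `mᵢ = merClass = (h̄ᵢ)_*[model meridian]` equals `+μ⁺ᵢ` if `h̄ᵢ : T → Base g`
preserves the (complex) orientations and `−μ⁺ᵢ` if it reverses them, and `IsLefschetzLink` allows
both, independently in `i` (`stub_Kas_mirror_link`, `…KasMirror.lean`: `h̄ᵢ ∘ diag(1,1,1,−1)` has the
same circle, framing, range, seam, longitude, and the reversed meridian).  So, with
`oᵢ = ±1` the orientation character of `h̄ᵢ`: `ℓᵢ = P(γᵢ) − oᵢ εᵢ mᵢ − Σ_{j>i} oⱼ stdSymp(γⱼ, γᵢ) mⱼ`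
and `ker Π = ⟨(0, (oⱼ stdSymp(γⱼ, a))ⱼ)⟩`; (F) and (G) as stated hold iff all `oᵢ = −1`.  For
orientation-PRESERVING handles the coefficient is `−εᵢ`: by the CONVENTION LEDGER of the design,
`merMap` should use the conjugate angle (`φ ↦ (θ₀, φ̄)/√2`, cf. `conjPt`).  CORRECTED STATEMENTS
(what `Kas_K2` needs, true by §2): (F′∧G′) `∃ o : Fin n → ℤˣ`, with
`Π_o (a, c) := P(a) + Σⱼ cⱼ • (oⱼ • merClass j)`: `Π_o` onto,
`ker Π_o = span {(0, (stdSymp(γⱼ, a))ⱼ)}`, and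
`∀ i, Π_o ((l.get i).1, Pi.single i (sgn (l.get i).2) + fun j => if i < j then stdSymp (l.get j).1 (l.get i).1 else 0) = longClass i`
(`oᵢ = −(orientation character of h̄ᵢ)`); equivalently (F), (G) verbatim under the extra hypothesis
that every `h̄ᵢ` REVERSES orientation, or with `merMap` conjugated under the hypothesis that every
`h̄ᵢ` PRESERVES it — either normalisation is available for `IsLefschetzHandlebody` by mirroring
(`isMultiAttachment_reframe_iff`).
-/

noncomputable section

set_option linter.dupNamespace false

open scoped Manifold ContDiff Topology
open Set Function Metric
open Literature.Topology.FourManifolds Literature.Topology.FourManifolds.LefschetzBase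
  Literature.AlgebraicTopology.SingularHomology Literature.Topology.FourManifolds.HandleAttachingMap

namespace Summit.SmoothPoincare4.SmoothPoincare4.Theorems.AcyclicBisectionExists.ModpBraidOrbits

/-- Local notation: the model Euclidean space `ℝ⁴`. -/
local notation "E4" => EuclideanSpace ℝ (Fin 4)
/-- Local notation: the unit circle in `ℝ²`. -/
local notation "𝕊¹" => (Metric.sphere (0 : EuclideanSpace ℝ (Fin 2)) 1)

/-! ## §1 The seam off the cores and Kas' model loops (the vocabulary of the design, §0) -/

section Loops

variable {g : ℕ} {ι : Type*} [Finite ι]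

/-- **The seam off the cores** `∂ Base g ∖ ⋃ᵢ Kᵢ`: the boundary points of the base off the attaching
circles of the handles — the piece `U` of `∂X` coming from the base. -/
def seamOff (h : ι → HandleAttachingMap 3 2 (Base g)) : Set (Base g) :=
  (𝓡∂ 4).boundary (Base g) ∩ (coresComplement h : Set (Base g))

/-- **The point `(θ, φ)/√2` of the Clifford torus** `|x_λ|² = |x_μ|² = ½` of `S³`, inside Kosinski's
tube `T ∖ S`. -/
def cliffordVec (θ φ : 𝕊¹) : E4 :=
  WithLp.toLp 2 ![(θ : EuclideanSpace ℝ (Fin 2)) 0 / Real.sqrt 2, (θ : EuclideanSpace ℝ (Fin 2)) 1 / Real.sqrt 2,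
    (φ : EuclideanSpace ℝ (Fin 2)) 0 / Real.sqrt 2, (φ : EuclideanSpace ℝ (Fin 2)) 1 / Real.sqrt 2]

/-- `|x_λ|² = ½` on the Clifford torus. [folklore] -/
theorem lamSq_cliffordVec (θ φ : 𝕊¹) : lamSq 2 (cliffordVec θ φ) = 1 / 2 := by
  -- adapted from `lamSq_cliffordVec` (work/stubs/Kas_Design.lean, W3-1)
  have h : (θ : EuclideanSpace ℝ (Fin 2)) 0 ^ 2 + (θ : EuclideanSpace ℝ (Fin 2)) 1 ^ 2 = 1 := by
    have h1 : ‖(θ : EuclideanSpace ℝ (Fin 2))‖ = 1 := norm_eq_of_mem_sphere θ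
    have h2 : ‖(θ : EuclideanSpace ℝ (Fin 2))‖ ^ 2 =
        (θ : EuclideanSpace ℝ (Fin 2)) 0 ^ 2 + (θ : EuclideanSpace ℝ (Fin 2)) 1 ^ 2 := by
      rw [EuclideanSpace.norm_sq_eq, Fin.sum_univ_two, Real.norm_eq_abs, Real.norm_eq_abs, sq_abs, sq_abs]
    rw [← h2, h1, one_pow]
  have hs : Real.sqrt 2 ^ 2 = 2 := Real.sq_sqrt (by norm_num)
  rw [lamSq_two_fin_four]
  simp only [cliffordVec, PiLp.toLp_apply, Matrix.cons_val_zero, Matrix.cons_val_one, div_pow, hs]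
  linarith

/-- `|x_μ|² = ½` on the Clifford torus. [folklore] -/
theorem muSq_cliffordVec (θ φ : 𝕊¹) : muSq 2 (cliffordVec θ φ) = 1 / 2 := by
  -- adapted from `muSq_cliffordVec` (work/stubs/Kas_Design.lean, W3-1)
  have h : (φ : EuclideanSpace ℝ (Fin 2)) 0 ^ 2 + (φ : EuclideanSpace ℝ (Fin 2)) 1 ^ 2 = 1 := by
    have h1 : ‖(φ : EuclideanSpace ℝ (Fin 2))‖ = 1 := norm_eq_of_mem_sphere φ
    have h2 : ‖(φ : EuclideanSpace ℝ (Fin 2))‖ ^ 2 =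
        (φ : EuclideanSpace ℝ (Fin 2)) 0 ^ 2 + (φ : EuclideanSpace ℝ (Fin 2)) 1 ^ 2 := by
      rw [EuclideanSpace.norm_sq_eq, Fin.sum_univ_two, Real.norm_eq_abs, Real.norm_eq_abs, sq_abs, sq_abs]
    rw [← h2, h1, one_pow]
  have hs : Real.sqrt 2 ^ 2 = 2 := Real.sq_sqrt (by norm_num)
  rw [muSq_two_fin_four]
  simp only [cliffordVec, PiLp.toLp_apply, Matrix.cons_val, div_pow, hs]
  linarith

/-- The Clifford torus lies on the unit sphere `∂𝔻⁴`. [folklore] -/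
theorem norm_cliffordVec (θ φ : 𝕊¹) : ‖cliffordVec θ φ‖ = 1 := by
  have h := lamSq_add_muSq 2 (cliffordVec θ φ)
  rw [lamSq_cliffordVec, muSq_cliffordVec] at h
  have h' : ‖cliffordVec θ φ‖ ^ 2 = 1 := by linarith
  nlinarith [norm_nonneg (cliffordVec θ φ)]

/-- The Clifford point as a point of Kosinski's tube `T = {x_λ ≠ 0} ⊆ 𝔻⁴`. -/
def cliffordPt (θ φ : 𝕊¹) : ↥(handleTube 3 2) :=
  ⟨⟨cliffordVec θ φ, mem_closedBall_zero_iff.2 (norm_cliffordVec θ φ).le⟩, by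
    rw [mem_handleTube]
    show lamSq 2 (cliffordVec θ φ) ≠ 0
    rw [lamSq_cliffordVec]; norm_num⟩

/-- `cliffordPt` is continuous in both angles. [folklore] -/
theorem continuous_cliffordPt : Continuous fun q : 𝕊¹ × 𝕊¹ => cliffordPt q.1 q.2 := by
  refine Continuous.subtype_mk (Continuous.subtype_mk ?_ _) _
  unfold cliffordVec
  refine (PiLp.continuous_toLp 2 _).comp (continuous_pi fun i => ?_)
  fin_cases i <;> simp <;> fun_prop

/-- The base angle `θ₀ = (1, 0)` of the model loops. -/
def baseAngle : 𝕊¹ := circlePt 0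

/-- The second coordinate of the base angle vanishes (`sin 0 = 0`). [folklore] -/
theorem baseAngle_apply_one : (baseAngle : EuclideanSpace ℝ (Fin 2)) 1 = 0 := by
  rw [baseAngle, circlePt_apply_one, mul_zero, Real.sin_zero]

/-- **The conjugate angle** `(cos, sin) ↦ (cos, −sin)` of the circle. -/
def conjPt (φ : 𝕊¹) : 𝕊¹ :=
  ⟨WithLp.toLp 2 ![(φ : EuclideanSpace ℝ (Fin 2)) 0, -(φ : EuclideanSpace ℝ (Fin 2)) 1], by
    have h1 : ‖(φ : EuclideanSpace ℝ (Fin 2))‖ = 1 := norm_eq_of_mem_sphere φ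
    rw [EuclideanSpace.norm_eq, Fin.sum_univ_two] at h1
    rw [mem_sphere_zero_iff_norm, EuclideanSpace.norm_eq, Fin.sum_univ_two]
    simpa using h1⟩

/-- The conjugate of `e^{2πit}` is `e^{−2πit}`. [folklore] -/
theorem conjPt_circlePt (t : ℝ) : conjPt (circlePt t) = circlePt (-t) := by
  apply Subtype.ext
  ext i
  fin_cases i
  · simp [conjPt, circlePt_apply_zero, mul_neg, Real.cos_neg]
  · simp [conjPt, circlePt_apply_one, mul_neg, Real.sin_neg]

/-- Conjugation is continuous. [folklore] -/
theorem continuous_conjPt : Continuous conjPt := by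
  refine Continuous.subtype_mk ?_ _
  refine (PiLp.continuous_toLp 2 _).comp (continuous_pi fun i => ?_)
  fin_cases i <;> simp <;> fun_prop

/-- **The image of a Clifford point under the `i`-th attaching map lies in the seam off the cores**
(a boundary point, `‖·‖ = 1`; off the `i`-th core since `|x_λ|² = ½ ≠ 1`, off the others by
disjointness of the attaching maps). [folklore] -/
theorem toFun_cliffordPt_mem_seamOff {h : ι → HandleAttachingMap 3 2 (Base g)}
    (hdisj : Pairwise fun i j => Disjoint (range (h i).toFun) (range (h j).toFun)) (i : ι) (θ φ : 𝕊¹) :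
    (h i).toFun (cliffordPt θ φ) ∈ seamOff h := by
  -- adapted from `toFun_cliffordPt_mem_seamOff` (work/stubs/Kas_Design.lean, W3-1)
  refine ⟨(h i).isBoundaryPoint _ (norm_cliffordVec θ φ), ?_⟩
  rw [SetLike.mem_coe, mem_coresComplement]
  intro j hj
  rw [mem_core_iff] at hj
  obtain ⟨y, hy, hyeq⟩ := hj
  by_cases hji : j = i
  · subst hji
    have : y = cliffordPt θ φ := (h j).injective hyeq
    rw [this] at hy
    exact absurd ((lamSq_cliffordVec θ φ).symm.trans hy) (by norm_num)
  · exact Set.disjoint_left.1 (hdisj hji) (mem_range_self y) (hyeq ▸ mem_range_self _)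

/-- **The `i`-th LONGITUDE loop** in the seam off the cores: `θ ↦ h̄ᵢ((θ, θ₀)/√2)`, the push-off of
the attaching circle `Kᵢ` along the handle framing `∂/∂x_μ,₁`. -/
def longMap {h : ι → HandleAttachingMap 3 2 (Base g)}
    (hdisj : Pairwise fun i j => Disjoint (range (h i).toFun) (range (h j).toFun)) (i : ι) :
    𝕊¹ → ↥(seamOff h) :=
  fun θ => ⟨(h i).toFun (cliffordPt θ baseAngle), toFun_cliffordPt_mem_seamOff hdisj i θ baseAngle⟩

/-- **The `i`-th MERIDIAN loop** in the seam off the cores: `φ ↦ h̄ᵢ((θ₀, φ)/√2)` — a meridian of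
`Kᵢ`, oriented by the handle `h̄ᵢ` (and NOT by `∂ Base g`: see §4). -/
def merMap {h : ι → HandleAttachingMap 3 2 (Base g)}
    (hdisj : Pairwise fun i j => Disjoint (range (h i).toFun) (range (h j).toFun)) (i : ι) :
    𝕊¹ → ↥(seamOff h) :=
  fun φ => ⟨(h i).toFun (cliffordPt baseAngle φ), toFun_cliffordPt_mem_seamOff hdisj i baseAngle φ⟩

/-- The longitude loop is continuous. [folklore] -/
theorem continuous_longMap {h : ι → HandleAttachingMap 3 2 (Base g)}
    (hdisj : Pairwise fun i j => Disjoint (range (h i).toFun) (range (h j).toFun)) (i : ι) :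
    Continuous (longMap hdisj i) :=
  Continuous.subtype_mk ((h i).continuous.comp
    (continuous_cliffordPt.comp (continuous_id.prodMk continuous_const))) _

/-- The meridian loop is continuous. [folklore] -/
theorem continuous_merMap {h : ι → HandleAttachingMap 3 2 (Base g)}
    (hdisj : Pairwise fun i j => Disjoint (range (h i).toFun) (range (h j).toFun)) (i : ι) :
    Continuous (merMap hdisj i) :=
  Continuous.subtype_mk ((h i).continuous.comp
    (continuous_cliffordPt.comp (continuous_const.prodMk continuous_id))) _

/-- **The longitude class `ℓᵢ ∈ H₁(seamOff h; ℤ)`** (Hurewicz class of the longitude loop). -/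
def longClass {h : ι → HandleAttachingMap 3 2 (Base g)}
    (hdisj : Pairwise fun i j => Disjoint (range (h i).toFun) (range (h j).toFun)) (i : ι) :
    singularHomology ℤ ℤ ↥(seamOff h) 1 :=
  loopClass ℤ ℤ (1 : ℤ) (loopPath (longMap hdisj i) (continuous_longMap hdisj i))

/-- **The meridian class `mᵢ ∈ H₁(seamOff h; ℤ)`** (Hurewicz class of the meridian loop). -/
def merClass {h : ι → HandleAttachingMap 3 2 (Base g)}
    (hdisj : Pairwise fun i j => Disjoint (range (h i).toFun) (range (h j).toFun)) (i : ι) :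
    singularHomology ℤ ℤ ↥(seamOff h) 1 :=
  loopClass ℤ ℤ (1 : ℤ) (loopPath (merMap hdisj i) (continuous_merMap hdisj i))

end Loops

/-! ## §2 Reversing a loop negates its Hurewicz class -/

section Classes

/-- **The Hurewicz class of the reversed loop is the opposite class** (`γ · γ⁻¹ ≃ refl`).
[folklore] -/
theorem loopClass_symm {X : Type} [TopologicalSpace X] {x : X} (γ : Path x x) :
    loopClass ℤ ℤ (1 : ℤ) γ.symm = -loopClass ℤ ℤ (1 : ℤ) γ := by
  have h : loopClass ℤ ℤ (1 : ℤ) (γ.trans γ.symm) = 0 := by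
    rw [← loopClass_eq_of_homotopic ℤ ℤ (1 : ℤ) ⟨Path.Homotopy.reflTransSymm γ⟩]
    exact loopClass_refl ℤ ℤ (1 : ℤ) x
  rw [loopClass_trans] at h
  exact eq_neg_of_add_eq_zero_right h

/-- **Reversing the parametrisation of a loop negates its Hurewicz class**: for `K : 𝕊¹ → X`,
the unit-period loop of `K ∘ conj` has class `−[K]`. [folklore] -/
theorem loopClass_loopPath_comp_conjPt {X : Type} [TopologicalSpace X] (K : 𝕊¹ → X) (hK : Continuous K) :
    loopClass ℤ ℤ (1 : ℤ) (loopPath (K ∘ conjPt) (hK.comp continuous_conjPt)) =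
      -loopClass ℤ ℤ (1 : ℤ) (loopPath K hK) := by
  rw [← loopClass_symm]
  refine loopClass_eq_of_coe_eq ℤ _ _ (funext fun s => ?_)
  show K (conjPt (circlePt s)) = K (circlePt (unitInterval.symm s))
  rw [conjPt_circlePt, unitInterval.coe_symm_eq, sub_eq_neg_add, circlePt_add_one]

end Classes

/-! ## §3 The registered sub-goal: reversing a loop negates its class -/

section SubGoal

/-- **Sub-goal `stub_Kas_loopClass_reverse` of stub `stub_modelsOn_counts`** (line
`modp-braid-orbits`, r9; wave 4, W4-G): for loops `K, K' : 𝕊¹ → X` with `K'(e^{2πit}) = K(e^{−2πit})`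
the Hurewicz classes of the unit-period loops satisfy `[K'] = −[K]` in `H₁(X; ℤ)` — the bookkeeping
behind "the mirrored handle has the opposite meridian class" (`…KasMirror.lean`) and behind the
orientation of Kas' meridians in (F′∧G′). [folklore] -/
theorem stub_Kas_loopClass_reverse :
    ∀ (X : Type) [TopologicalSpace X] (K K' : Metric.sphere (0 : EuclideanSpace ℝ (Fin 2)) 1 → X)
      (hK : Continuous K) (hK' : Continuous K'),
      (∀ t : ℝ, K' (Literature.Topology.FourManifolds.circlePt t) =
        K (Literature.Topology.FourManifolds.circlePt (-t))) →
      Literature.AlgebraicTopology.SingularHomology.loopClass ℤ ℤ (1 : ℤ)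
          (Literature.Topology.FourManifolds.LefschetzBase.loopPath K' hK') =
        -Literature.AlgebraicTopology.SingularHomology.loopClass ℤ ℤ (1 : ℤ)
          (Literature.Topology.FourManifolds.LefschetzBase.loopPath K hK) := by
  intro X _ K K' hK hK' hKK'
  rw [← loopClass_loopPath_comp_conjPt K hK]
  refine loopClass_eq_of_coe_eq ℤ _ _ (funext fun s => ?_)
  show K' (circlePt s) = K (conjPt (circlePt s))
  rw [hKK', conjPt_circlePt]

end SubGoal

end Summit.SmoothPoincare4.SmoothPoincare4.Theorems.AcyclicBisectionExists.ModpBraidOrbits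

end
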